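import Summits.HodgeConjecture.HodgeConjecture.Theorems.F0P5TP2StubR2Psi
import Literature.NumberTheory.Automorphic.UnitaryGroupCohomologicalForms
import Literature.AlgebraicGeometry.ShimuraVarieties.UnitaryCurveConeExtension
import HarnessLib

/-!
# Crux `HLiu418`, K-lane sub-line `F0_P5TP2SpectralProjection` — stub **(R₂)** `stub_R₂ : StubR₂RegularOfReproduced`:
# REGULARITY OF REPRODUCED CLASSES (the closer; one coordinate, chart `γ z = exp (X z)`)

Cell hodgecm-mathlib (D-0151), FLOOR 0, programme P5 (Alb-CM), crux item `HLiu418` = stmt-HodgeConjecture-24832; K-lane sub-line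
`Cruxes/HLiu418/Lines/F0_P5TP2SpectralProjection.lean` (skeleton v0 by A-p14 (g16), sha16 ce659ab5fe57535c; F0P5-plan (g0) SHAPE PASS
2026-08-31T02:03:58Z), stub **(R₂) `stub_R₂ : StubR₂RegularOfReproduced`** (:283; hand A-p04 (g21)).  THEOREMS ONLY (no definition, no
instance, no notation, no named fact, no `sorry`); `--supports stmt-HodgeConjecture-24832 --as helper`.  HC_CM is proved only modulo the 7
printed citations until rung 0 closes; this file proves nothing about them.  Companions: ★ `Theorems/F0P5TP2StubR2Engine` (§0–§2) and ★ `Theorems/F0P5TP2StubR2Psi` (§3, the representative `Ψ`).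

THE STATEMENT (`stubR₂_holds`; the Lines-local bundles `G2` ∕ `sec₁` ∕ `Kc₁` ∕ `IsRegularKernel₁` ∕ `kernelOp₁` ∕ `probeP₁` ∕ `orbitP₁` ∕ `Realises₁`
UNFOLDED — a `Theorems/` file cannot import a `Cruxes/…/Lines/` module): in the letter's setting (`L` CM, `ι : L →+* ℂ`, `H ∈ M₂(L)` with
`ᵗ(c g)(t H) g = diag dV`, `dV` real non-zero, `σ_ι H` hermitian, `diag dV` positive definite at the embeddings off `ι`'s place, `[L:ℚ] ≥ 4`;
a cone frame `𝔣`, a probe `X : ℂ →ₗ[ℝ] 𝔲(σ_ι H)` with its family `γ z = exp (X z)` in `U := U(σ_ι H)(ℂ)`; `μ` automorphic, `ν` Haar on `U`),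
for a kernel `A` on `U` that is continuous, compactly supported, `C¹` along the left probes `z ↦ A (γ z · u′)` with jointly continuous probe
derivative, an `L²` class `w` that is REPRODUCED (`∫ A(u) • R(sec u) w dν = w`), right `K_c`-invariant and right invariant under an open `K_f`,
there is `Ψ : U(H)(𝔸) → ℂ` with: (R1) left `A_G·G(K)`-invariance, (R2) CONTINUITY, (R3) `toQuotFun Ψ = w` a.e., (R4) differentiable probes
`z ↦ Ψ(y sec(γ z))` at `0` for every `y`, (R5) probe derivatives continuous in `y`, (R6) probe derivatives REPRESENTING the `L²`-derivative of
the orbit map `z ↦ R(sec (γ z)) w` at `0`.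

THE PROOF = ★ `Theorems/F0P2dStubR` (F0P2-p04 (g2), rank 3) at one coordinate: shrink `K_f` to a compact open one (★ `finAdelicIntegralLevel`);
`K_c` is compact because `σ_w H` is ± definite at every complex `w ≠ cmPlace L ι` (§0: `t` is `c`-real since `tH` and `H` are both
`c`-hermitian and `H ≠ 0`, so `σ_w H = σ_w(t)⁻¹ · ᵗ(σ_w g⁻¹)̄ σ_w(diag dV) σ_w g⁻¹` with `σ_w(t) ∈ ℝˣ`; ★ `isCompact_map_ker_archAt`); take an
EXACTLY `K_c K_f`-invariant representative `w̄` (engine §1); put **`Ψ(x) := ∫ A(u) w̄(x sec(u)) dν(u)`**.  Every base point is good (engine §2), so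
(R1) ★ `orbitalIntegral_mul_left`; (R2) engine `continuous_orbitalIntegral_of_invariant`; (R3) the reproduction hypothesis and the Fubini
representative ★ `coeFn_integral_smul_rightRegular_toLp_eq_orbitalIntegral`; (R4)∕(R5) ★ `hasFDerivAt_orbitalIntegral_chart` ∕
`fderiv_orbitalIntegral_chart_apply` (A-p02 (g18), ★ `AutomorphicFormsL2OrbitalSmoothingChart`, chart `e := γ`, `γ(−z) = (γ z)⁻¹` by
`exp(−X) exp X = 1`); (R6) ★ `fderiv_rightRegular_chart_integral_smul_apply` + the same Fubini representative for the derivative kernel.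

* §0 `posDef_or_neg_posDef_map_embedding`, `isCompact_Kc` (the letter's binders ⇒ compact `K_c`); `continuous_expFamily`, `expFamily_neg`;
* (★ `Theorems/F0P5TP2StubR2Psi`, generic rank `N`, one place `w₁`, any odd continuous chart) `psi_mul_left`, `continuous_psi`, `toQuotFun_psi_ae_eq`,
  `hasFDerivAt_probe_psi`, `fderiv_probe_psi_apply`, `continuous_fderiv_probe_psi`, `fderiv_orbit_apply`, `toQuotFun_fderiv_probe_psi_ae_eq`,
  `exists_realises` (R1)–(R6);
* §4 **`stubR₂_holds`** — the stub with unfolded bundles.  Registrar's fold: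
  `stub_R₂ := fun L _ _ _ ι H dV hdV hdV0 t ht g hdiag hJ hT hdef h4 𝔣 X hXu γ hγ μ _ _ _ ν _ A hA w hrep hkc hkf => by
    obtain ⟨Ψ, h⟩ := F0P5TP2StubR2.stubR₂_holds L ι H dV hdV hdV0 t ht g hdiag hJ hT hdef h4 𝔣 X hXu γ hγ μ ν A hA.cont hA.supp hA.diff
      hA.contDeriv w hrep hkc hkf
    exact ⟨Ψ, h.1, h.2.1, h.2.2.1, h.2.2.2.1, h.2.2.2.2.1, h.2.2.2.2.2⟩`.

## References
* [Borel1997] A. Borel, *Automorphic forms on SL₂(ℝ)*, Cambridge Tracts 130 (1997), Thm. 2.13–2.14 and §8.4, §5.14.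
* [HarishChandra1966] Harish-Chandra, *Discrete series for semisimple Lie groups II*, Acta Math. 116 (1966), §8 (`φ = φ ∗ α`).
* [BorelJacquet1979] A. Borel, H. Jacquet, Corvallis PSPM 33.1 (1979), §4.1–4.2, §4.6.
* [PlatonovRapinchuk1994] V. Platonov, A. Rapinchuk, *Algebraic groups and number theory* (1994), §2.3, §3.2 Thm. 3.1.
-/

set_option autoImplicit false
-- the mandated namespace has the single-problem summit's repeated segment (`HodgeConjecture.HodgeConjecture`)
set_option linter.dupNamespace false

noncomputable section

namespace Summit.HodgeConjecture.HodgeConjecture.Cruxes.HLiu418.F0P5TP2StubR2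

open scoped Topology ENNReal Pointwise Matrix ComplexOrder ComplexConjugate
open MeasureTheory NumberField NumberField.InfinitePlace Set Filter Function
open Literature.NumberTheory.Automorphic Literature.NumberTheory.Automorphic.UnitaryGroup
open Literature.NumberTheory.Automorphic.UnitaryGroup.CotangentForms (toQuotFun toQuotFun_mk)
open Literature.NumberTheory.Automorphic.OrbitalSmoothingChart
open Literature.AlgebraicGeometry.ShimuraVarieties
open Summit.HodgeConjecture.HodgeConjecture.Cruxes.HLiu418.F0P5TP2StubR2Engine
open Summit.HodgeConjecture.HodgeConjecture.Cruxes.HLiu418.F0P5TP2StubR2Psi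

/-! ## §0 The letter's binders make `K_c` compact; the probe family `γ z = exp (X z)` is an odd continuous chart -/

section Definite

variable (L : Type) [Field L] [NumberField L] [IsCMField L] (ι : L →+* ℂ)

/-- A positive definite complex matrix scaled by a positive REAL scalar is positive definite. [folklore] -/
theorem posDef_real_smul {n : Type*} [Fintype n] [DecidableEq n] {P : Matrix n n ℂ} (hP : P.PosDef) {s : ℝ} (hs : 0 < s) :
    ((s : ℂ) • P).PosDef := by
  refine Matrix.PosDef.of_dotProduct_mulVec_pos ?_ fun x hx => ?_
  · rw [Matrix.IsHermitian, Matrix.conjTranspose_smul, hP.1.eq]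
    simp
  · rw [Matrix.smul_mulVec, dotProduct_smul, smul_eq_mul]
    exact mul_pos (Complex.zero_lt_real.2 hs) (hP.dotProduct_mulVec_pos hx)

/-- **± DEFINITENESS AWAY FROM `ι` FROM THE LETTER'S DIAGONALISATION.**  If `ᵗ(c g) (t • H) g = diag dV` with `dV` `c`-real and non-zero,
`σ_ι H` hermitian (so `H` is `c`-hermitian), and `σ(diag dV)` positive definite for every complex embedding `σ` off `ι`'s place, then at every
complex place `w ≠ cmPlace L ι` the matrix `σ_w H` is positive OR negative definite: `t` is `c`-real (both `tH` and `H ≠ 0` are `c`-hermitian),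
`σ_w(t) ∈ ℝˣ`, and `σ_w H = σ_w(t)⁻¹ · (σ_w g⁻¹)ᴴ σ_w(diag dV) σ_w(g⁻¹)`. [cite: PlatonovRapinchuk1994, §2.3] -/
theorem posDef_or_neg_posDef_map_embedding (H : Matrix (Fin 2) (Fin 2) L) (dV : Fin 2 → L)
    (hdV : ∀ i, IsCMField.complexConj L (dV i) = dV i) (hdV0 : ∀ i, dV i ≠ 0) (t : L) (ht : t ≠ 0) (g : GL (Fin 2) L)
    (hdiag : formCongr ((IsCMField.complexConj L : L ≃ₐ[↥(maximalRealSubfield L)] L) : L →+* L) g (t • H) = Matrix.diagonal dV)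
    (hJ : (H.map (cmPlace L ι).1.embedding).IsHermitian)
    (hdef : ∀ τ' : L →+* ℂ, InfinitePlace.mk τ' ≠ InfinitePlace.mk ι → ((Matrix.diagonal dV).map τ').PosDef)
    (w : {w : InfinitePlace L // IsComplex w}) (hw : w ≠ cmPlace L ι) :
    (H.map w.1.embedding).PosDef ∨ (-H.map w.1.embedding).PosDef := by
  set cL : L →+* L := ((IsCMField.complexConj L : L ≃ₐ[↥(maximalRealSubfield L)] L) : L →+* L) with hcL
  have hcLx : ∀ (τ : L →+* ℂ) (x : L), τ (cL x) = starRingEnd ℂ (τ x) := fun τ x =>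
    IsCMField.complexEmbedding_complexConj L τ x
  -- the congruence read at any complex embedding `τ`
  have hM : t • H = formCongr cL g⁻¹ (Matrix.diagonal dV) := by rw [← hdiag, formCongr_inv_formCongr]
  have hmapτ : ∀ τ : L →+* ℂ, (t • H).map τ =
      (((g⁻¹ : GL (Fin 2) L) : Matrix (Fin 2) (Fin 2) L).map τ)ᴴ * (Matrix.diagonal dV).map τ *
        ((g⁻¹ : GL (Fin 2) L) : Matrix (Fin 2) (Fin 2) L).map τ := by
    intro τ
    rw [hM, formCongr_map cL τ (hcLx τ)]
    rfl
  have hsmulτ : ∀ τ : L →+* ℂ, (t • H).map τ = τ t • H.map τ := fun τ => by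
    ext i j
    simp only [Matrix.map_apply, Matrix.smul_apply, smul_eq_mul, map_mul]
  -- `σ(diag dV)` is hermitian at every `τ` (real entries)
  have hDherm : ∀ τ : L →+* ℂ, ((Matrix.diagonal dV).map τ).IsHermitian := by
    intro τ
    rw [Matrix.diagonal_map (map_zero τ)]
    refine Matrix.isHermitian_diagonal_of_self_adjoint _ (funext fun i => ?_)
    show starRingEnd ℂ (τ (dV i)) = τ (dV i)
    rw [← hcLx, show cL (dV i) = dV i from hdV i]
  -- hence `σ(t) • σ(H)` is hermitian at every `τ`
  have htHherm : ∀ τ : L →+* ℂ, (τ t • H.map τ).IsHermitian := fun τ => by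
    rw [← hsmulτ, hmapτ]
    exact Matrix.isHermitian_conjTranspose_mul_mul _ (hDherm τ)
  -- `H ≠ 0`
  have hH0 : H ≠ 0 := by
    intro h0
    rw [h0, smul_zero] at hdiag
    have h1 : Matrix.diagonal dV = 0 := by
      rw [← hdiag]
      simp [formCongr]
    exact hdV0 0 (by simpa using congrFun (congrFun h1 0) 0)
  -- `t` is `c`-real: read at `σ_ι`, where `σ_ι H` is hermitian and non-zero
  set σ₁ : L →+* ℂ := (cmPlace L ι).1.embedding with hσ₁
  have hct : starRingEnd ℂ (σ₁ t) = σ₁ t := by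
    have h1 : (σ₁ t • H.map σ₁)ᴴ = σ₁ t • H.map σ₁ := (htHherm σ₁).eq
    rw [Matrix.conjTranspose_smul, hJ.eq] at h1
    have h2 : (star (σ₁ t) - σ₁ t) • H.map σ₁ = 0 := by rw [sub_smul, h1, sub_self]
    rcases smul_eq_zero.1 h2 with h3 | h3
    · exact (sub_eq_zero.1 h3)
    · exfalso
      apply hH0
      ext i j
      have := congrFun (congrFun h3 i) j
      simpa [Matrix.map_apply] using this
  have hct' : cL t = t := σ₁.injective (by rw [hcLx, hct])
  -- at the place `w ≠ cmPlace L ι`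
  set τ : L →+* ℂ := w.1.embedding with hτ
  have hτι : InfinitePlace.mk τ ≠ InfinitePlace.mk ι := by
    intro h
    apply hw
    apply Subtype.ext
    rw [← InfinitePlace.mk_embedding w.1]
    exact h
  have hreal : starRingEnd ℂ (τ t) = τ t := by rw [← hcLx, hct']
  have hτt0 : τ t ≠ 0 := by
    intro h
    exact ht (τ.injective (by rw [h, map_zero]))
  set r : ℝ := (τ t).re with hr
  have hτt : τ t = (r : ℂ) := (Complex.conj_eq_iff_re.1 hreal).symm
  have hr0 : r ≠ 0 := fun h => hτt0 (by rw [hτt, h, Complex.ofReal_zero])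
  -- `σ_τ(tH)` is positive definite
  have hP : ((t • H).map τ).PosDef := by
    rw [hmapτ]
    have hU : IsUnit (((g⁻¹ : GL (Fin 2) L) : Matrix (Fin 2) (Fin 2) L).map τ) :=
      ⟨Matrix.GeneralLinearGroup.map τ g⁻¹, rfl⟩
    rw [← Matrix.star_eq_conjTranspose]
    exact (Matrix.IsUnit.posDef_star_left_conjugate_iff hU).2 (hdef τ hτι)
  have hHτ : H.map τ = ((r⁻¹ : ℝ) : ℂ) • (t • H).map τ := by
    rw [hsmulτ, hτt, smul_smul, Complex.ofReal_inv, inv_mul_cancel₀ (by exact_mod_cast hr0), one_smul]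
  rcases lt_or_gt_of_ne hr0 with hneg | hpos
  · right
    rw [hHτ, ← neg_smul, ← Complex.ofReal_neg, ← inv_neg]
    exact posDef_real_smul hP (inv_pos.2 (neg_pos.2 hneg))
  · left
    rw [hHτ]
    exact posDef_real_smul hP (inv_pos.2 hpos)

/-- **`K_c` IS COMPACT under the letter's binders**: the archimedean factor of `U(H)(𝔸_{L⁺})` away from `cmPlace L ι` (the skeleton's `Kc₁ L ι H`,
written out) is compact, by ★ `isCompact_map_ker_archAt` and `posDef_or_neg_posDef_map_embedding`. [cite: PlatonovRapinchuk1994, §3.2 Thm. 3.1] -/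
theorem isCompact_Kc (H : Matrix (Fin 2) (Fin 2) L) (dV : Fin 2 → L)
    (hdV : ∀ i, IsCMField.complexConj L (dV i) = dV i) (hdV0 : ∀ i, dV i ≠ 0) (t : L) (ht : t ≠ 0) (g : GL (Fin 2) L)
    (hdiag : formCongr ((IsCMField.complexConj L : L ≃ₐ[↥(maximalRealSubfield L)] L) : L →+* L) g (t • H) = Matrix.diagonal dV)
    (hJ : (H.map (cmPlace L ι).1.embedding).IsHermitian)
    (hdef : ∀ τ' : L →+* ℂ, InfinitePlace.mk τ' ≠ InfinitePlace.mk ι → ((Matrix.diagonal dV).map τ').PosDef) :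
    IsCompact ((((archAt (↥(maximalRealSubfield L)) L (IsCMField.complexConj L) 2 H (cmPlace L ι)
        (complexConj_smul_infinitePlace L (cmPlace L ι).1) (IsCMField.complexConj_ne_one L)).ker).map
        (archToAdelic (↥(maximalRealSubfield L)) L (IsCMField.complexConj L) 2 H)) :
      Set (adelicGroupData (↥(maximalRealSubfield L)) L (IsCMField.complexConj L) 2 H).Adelic) :=
  isCompact_map_ker_archAt (↥(maximalRealSubfield L)) L (IsCMField.complexConj L) 2 H (IsCMField.complexConj_ne_one L)
    (complexConj_smul_infinitePlace L) (cmPlace L ι)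
    (fun w hw => posDef_or_neg_posDef_map_embedding L ι H dV hdV hdV0 t ht g hdiag hJ hdef w hw)

end Definite

section Chart

open scoped Matrix.Norms.Operator

variable {E : Type} [Field E] [NumberField E] {N : ℕ} {J : Matrix (Fin N) (Fin N) E} {w₁ : {w : InfinitePlace E // IsComplex w}}

omit [NumberField E] in
/-- The probe family `γ z = exp (X z)` (`X` real-linear) is ODD: `γ (−z) = (γ z)⁻¹` (`exp(−X) exp(X) = 1`, ★ `UnitaryCurveCone.exp_mul_exp_neg`).
[cite: Borel1997, §5.14] -/
theorem expFamily_neg (X : ℂ →ₗ[ℝ] Matrix (Fin N) (Fin N) ℂ) (γ : ℂ → archLocal E N J w₁)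
    (hγ : ∀ z, ((γ z : GL (Fin N) ℂ) : Matrix (Fin N) (Fin N) ℂ) = NormedSpace.exp (X z)) (z : ℂ) :
    γ (-z) = (γ z)⁻¹ := by
  refine eq_inv_of_mul_eq_one_left (Subtype.ext (Units.ext ?_))
  rw [Subgroup.coe_mul, Units.val_mul, hγ, hγ, map_neg, Subgroup.coe_one, Units.val_one]
  exact (UnitaryCurveCone.exp_mul_exp_neg (X z)).2

omit [NumberField E] in
/-- The probe family `γ z = exp (X z)` is CONTINUOUS into `U(σ_{w₁}J)(ℂ) ≤ GL_N(ℂ)` (units topology: `exp ∘ X` and `exp ∘ (−X)` are continuous).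
[cite: Borel1997, §5.14] -/
theorem continuous_expFamily (X : ℂ →ₗ[ℝ] Matrix (Fin N) (Fin N) ℂ) (γ : ℂ → archLocal E N J w₁)
    (hγ : ∀ z, ((γ z : GL (Fin N) ℂ) : Matrix (Fin N) (Fin N) ℂ) = NormedSpace.exp (X z)) : Continuous γ := by
  have hX : Continuous X := X.continuous_of_finiteDimensional
  have h1 : Continuous fun z : ℂ ↦ NormedSpace.exp (X z) := NormedSpace.exp_continuous.comp hX
  have h2 : Continuous fun z : ℂ ↦ NormedSpace.exp (X (-z)) := NormedSpace.exp_continuous.comp (hX.comp continuous_neg)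
  refine continuous_induced_rng.2 (Units.continuous_iff.2 ⟨h1.congr fun z => (hγ z).symm, h2.congr fun z => ?_⟩)
  show NormedSpace.exp (X (-z)) = (((γ z)⁻¹ : archLocal E N J w₁) : GL (Fin N) ℂ)
  rw [← expFamily_neg X γ hγ z, hγ]

end Chart

/-! ## §4 STUB (R₂) — the registered statement with the Lines-local bundles unfolded -/

/-- **STUB (R₂) `stub_R₂ : StubR₂RegularOfReproduced` — REGULARITY OF REPRODUCED CLASSES** (skeleton v0 ce659ab5 :283, body VERBATIM with
`G2 L H` ↦ `adelicGroupData L⁺ L c̄ 2 H`, `sec₁ L ι H` ↦ `adelicSingle … (cmPlace L ι)`, `Kc₁ L ι H` ↦ `(ker archAt (cmPlace L ι)).map archToAdelic`,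
`IsRegularKernel₁ γ A` ↦ its four fields `hAc hAs hAd hAD`, `kernelOp₁` ↦ the reproduction hypothesis `hrep`, and the conclusion
`Realises₁ … Ψ w` ↦ the conjunction of its six fields `leftInv ∧ cont ∧ aeEq ∧ diff ∧ contDeriv ∧ derivAe` with `probeP₁` ∕ `orbitP₁` unfolded).
`K_c` is compact by §0; the chart `γ` is continuous and odd by §0; then `exists_realises`.  Registrar's fold (checked by paste against the
skeleton bytes): `stub_R₂ := fun L _ _ _ ι H dV hdV hdV0 t ht g hdiag hJ hT hdef h4 𝔣 X hXu γ hγ μ _ _ _ ν _ A hA w hrep hkc hkf => by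
  obtain ⟨Ψ, h⟩ := F0P5TP2StubR2.stubR₂_holds L ι H dV hdV hdV0 t ht g hdiag hJ hT hdef h4 𝔣 X hXu γ hγ μ ν A hA.cont hA.supp hA.diff hA.contDeriv
    w hrep hkc hkf
  exact ⟨Ψ, h.1, h.2.1, h.2.2.1, h.2.2.2.1, h.2.2.2.2.1, h.2.2.2.2.2⟩`.
[cite: Borel1997, Thm. 2.13 and §8.4] [cite: HarishChandra1966, §8] [cite: BorelJacquet1979, §4.1–4.2] -/
theorem stubR₂_holds (L : Type) [Field L] [NumberField L] [IsCMField L] (ι : L →+* ℂ) (H : Matrix (Fin 2) (Fin 2) L)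
    (dV : Fin 2 → L) (hdV : ∀ i, IsCMField.complexConj L (dV i) = dV i) (hdV0 : ∀ i, dV i ≠ 0)
    (t : L) (ht : t ≠ 0) (g : GL (Fin 2) L)
    (hdiag : formCongr ((IsCMField.complexConj L : L ≃ₐ[↥(maximalRealSubfield L)] L) : L →+* L) g (t • H) = Matrix.diagonal dV)
    (hJ : (H.map (cmPlace L ι).1.embedding).IsHermitian)
    (_hT : ∃ T : GL (Fin 2) ℂ, formCongr (starRingEnd ℂ) T ((Matrix.diagonal dV).map ι) = Matrix.diagonal ![(1 : ℂ), -1])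
    (hdef : ∀ τ' : L →+* ℂ, InfinitePlace.mk τ' ≠ InfinitePlace.mk ι → ((Matrix.diagonal dV).map τ').PosDef)
    (_h4 : 4 ≤ Module.finrank ℚ L)
    (_𝔣 : UnitaryCurveForms.ConeFrame L H (cmPlace L ι)) (X : ℂ →ₗ[ℝ] Matrix (Fin 2) (Fin 2) ℂ)
    (_hXu : ∀ z, (X z)ᴴ * H.map (cmPlace L ι).1.embedding + H.map (cmPlace L ι).1.embedding * X z = 0)
    (γ : ℂ → archLocal L 2 H (cmPlace L ι))
    (hγ : ∀ z, ((γ z : GL (Fin 2) ℂ) : Matrix (Fin 2) (Fin 2) ℂ) = NormedSpace.exp (X z))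
    (μ : Measure (adelicGroupData (↥(maximalRealSubfield L)) L (IsCMField.complexConj L) 2 H).automorphicQuotient)
    [(adelicGroupData (↥(maximalRealSubfield L)) L (IsCMField.complexConj L) 2 H).IsAutomorphicMeasure μ]
    [MeasurableSpace (archLocal L 2 H (cmPlace L ι))] [BorelSpace (archLocal L 2 H (cmPlace L ι))]
    (ν : Measure (archLocal L 2 H (cmPlace L ι))) [ν.IsHaarMeasure] (A : archLocal L 2 H (cmPlace L ι) → ℂ)
    (hAc : Continuous A) (hAs : HasCompactSupport A)
    (hAd : ∀ u' : archLocal L 2 H (cmPlace L ι), ContDiff ℝ 1 fun z : ℂ ↦ A (γ z * u'))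
    (hAD : Continuous fun p : ℂ × archLocal L 2 H (cmPlace L ι) ↦ fderiv ℝ (fun z : ℂ ↦ A (γ z * p.2)) p.1)
    (w : (adelicGroupData (↥(maximalRealSubfield L)) L (IsCMField.complexConj L) 2 H).L2 μ)
    (hrep : (∫ u, A u • (adelicGroupData (↥(maximalRealSubfield L)) L (IsCMField.complexConj L) 2 H).rightRegular μ
      (adelicSingle (↥(maximalRealSubfield L)) L (IsCMField.complexConj L) 2 H (IsCMField.complexConj_ne_one L)
        (UnitaryGroup.complexConj_smul_infinitePlace L) (cmPlace L ι) u) w ∂ν) = w)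
    (hkc : ∀ k ∈ ((archAt (↥(maximalRealSubfield L)) L (IsCMField.complexConj L) 2 H (cmPlace L ι)
        (UnitaryGroup.complexConj_smul_infinitePlace L (cmPlace L ι).1) (IsCMField.complexConj_ne_one L)).ker).map
        (archToAdelic (↥(maximalRealSubfield L)) L (IsCMField.complexConj L) 2 H),
      (adelicGroupData (↥(maximalRealSubfield L)) L (IsCMField.complexConj L) 2 H).rightRegular μ k w = w)
    (hkf : ∃ Kf : Subgroup (finAdelic (↥(maximalRealSubfield L)) L (IsCMField.complexConj L) 2 H),
      IsOpen (Kf : Set (finAdelic (↥(maximalRealSubfield L)) L (IsCMField.complexConj L) 2 H)) ∧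
        ∀ k ∈ Kf, (adelicGroupData (↥(maximalRealSubfield L)) L (IsCMField.complexConj L) 2 H).rightRegular μ
          (finAdelicToAdelic (↥(maximalRealSubfield L)) L (IsCMField.complexConj L) 2 H k) w = w) :
    ∃ Ψ : (adelicGroupData (↥(maximalRealSubfield L)) L (IsCMField.complexConj L) 2 H).Adelic → ℂ,
      (∀ γr ∈ (adelicGroupData (↥(maximalRealSubfield L)) L (IsCMField.complexConj L) 2 H).quotientSubgroup, ∀ x, Ψ (γr * x) = Ψ x) ∧
      Continuous Ψ ∧
      toQuotFun (adelicGroupData (↥(maximalRealSubfield L)) L (IsCMField.complexConj L) 2 H) Ψ =ᵐ[μ]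
        ((w : (adelicGroupData (↥(maximalRealSubfield L)) L (IsCMField.complexConj L) 2 H).L2 μ) :
          (adelicGroupData (↥(maximalRealSubfield L)) L (IsCMField.complexConj L) 2 H).automorphicQuotient → ℂ) ∧
      (∀ y, DifferentiableAt ℝ (fun z : ℂ ↦ Ψ (y *
        adelicSingle (↥(maximalRealSubfield L)) L (IsCMField.complexConj L) 2 H (IsCMField.complexConj_ne_one L)
          (UnitaryGroup.complexConj_smul_infinitePlace L) (cmPlace L ι) (γ z))) 0) ∧
      (∀ z : ℂ, Continuous fun y ↦ fderiv ℝ (fun z : ℂ ↦ Ψ (y *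
        adelicSingle (↥(maximalRealSubfield L)) L (IsCMField.complexConj L) 2 H (IsCMField.complexConj_ne_one L)
          (UnitaryGroup.complexConj_smul_infinitePlace L) (cmPlace L ι) (γ z))) 0 z) ∧
      (∀ z : ℂ,
        toQuotFun (adelicGroupData (↥(maximalRealSubfield L)) L (IsCMField.complexConj L) 2 H)
            (fun y ↦ fderiv ℝ (fun z : ℂ ↦ Ψ (y *
              adelicSingle (↥(maximalRealSubfield L)) L (IsCMField.complexConj L) 2 H (IsCMField.complexConj_ne_one L)
                (UnitaryGroup.complexConj_smul_infinitePlace L) (cmPlace L ι) (γ z))) 0 z) =ᵐ[μ]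
          ((fderiv ℝ (fun z : ℂ ↦ (adelicGroupData (↥(maximalRealSubfield L)) L (IsCMField.complexConj L) 2 H).rightRegular μ
              (adelicSingle (↥(maximalRealSubfield L)) L (IsCMField.complexConj L) 2 H (IsCMField.complexConj_ne_one L)
                (UnitaryGroup.complexConj_smul_infinitePlace L) (cmPlace L ι) (γ z)) w) 0 z :
              (adelicGroupData (↥(maximalRealSubfield L)) L (IsCMField.complexConj L) 2 H).L2 μ) :
            (adelicGroupData (↥(maximalRealSubfield L)) L (IsCMField.complexConj L) 2 H).automorphicQuotient → ℂ)) :=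
  exists_realises (↥(maximalRealSubfield L)) L (IsCMField.complexConj L) 2 H (IsCMField.complexConj_ne_one L)
    (UnitaryGroup.complexConj_smul_infinitePlace L) (cmPlace L ι) μ ν A
    (isCompact_Kc L ι H dV hdV hdV0 t ht g hdiag hJ hdef) (continuous_expFamily X γ hγ) (expFamily_neg X γ hγ) hAc hAs hAd hAD
    w hrep hkc hkf

end Summit.HodgeConjecture.HodgeConjecture.Cruxes.HLiu418.F0P5TP2StubR2

end
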